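import Literature.NumberTheory.DiophantineGeometry.OptimizedSimplifiedHeightBoundsProofs
import Literature.NumberTheory.DiophantineGeometry.AbcAsymptoticHeightBoundProofs
import Mathlib.Analysis.Complex.ExponentialBounds
import HarnessLib

/-!
# The first modularity bounds (von Känel 2014, Cor. 7.2/7.4/7.5; Murty–Pasten 2013, Thm 1.1/1.2)
# from von Känel–Matschke's Prop. 10.1/10.2 and hence from the §10 roots — PROVED deductions

Topic `Literature/NumberTheory/DiophantineGeometry` (family `abc`, LADDER-ABC A1: the *modular method*).
A proofs-only companion (theorems only; NO definition, NO new named fact, nothing restated; D-0014,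
D-0026) of `SUnitMordellHeightBoundsModularity.lean` (vKM Prop. 10.1, 10.2; vK 2014 Cor. 7.2–7.6 as
named facts) and `SUnitAbcBoundsCongruenceNumber.lean` (Murty–Pasten 2013 Thm 1.1, 1.2 as named facts).

Sources (held texts, read at the locators): R. von Känel, B. Matschke, arXiv:1605.06079 = Mem. AMS 286
(2023) no. 1419 [`VonkanelMatschke2023`], §10.1.1: *"Proposition (eq:simplemordell) provides the actual
best height bound for Mordell equations, since it updates the inequality
`max(h(x),h(y)) ≤ h(a) + 4·36a_S log(36a_S)²` in [rvk:modular]"*, §10.1.2: *"Proposition (prop:su)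
updates the inequalities `h ≤ 4.8 N_S log N_S + 13 N_S + 25` in Murty–Pasten and
`h ≤ 3·2⁶ N_S log(2⁷N_S)² + 65` in [rvk:modular]"*; R. von Känel, TLMS 1 (2014) = arXiv:1310.7263
[`VonKanelModuli2014`], §7.3.4: *"The following result [Cor. 7.5] is a direct consequence of
Corollary (cor:m) [= Cor. 7.4]"*; M. R. Murty, H. Pasten, *Modular forms and effective Diophantine
approximation*, J. Number Theory 133 (2013) [`MurtyPasten2013`], Thm 1.1 / 1.2 (both parts).

## What is proved here (pure real-analysis dominations + the tree's root-conditional theorems)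

* `second_display_le_vonKanel2014` — for real `N ≥ 1`:
  `(12/5)N log N + (9/10)N log₃(16N) + 8.26N + 28 ≤ (3/2)(2⁷N)(log 2⁷N)² + 65`; hence
  `vonKanel2014_sUnit_height_le` (vK Cor. 7.2) from `abc_log_max_le_refined` (Prop. 10.6, via the
  second display of Prop. 10.2 for every `S`, `sUnitEquation_height_le_two_of_abc_log_max_le_refined`),
  from `sUnitEquation_height_le` (Prop. 10.2) itself, and from the roots {modularity, Ogg–Saito schema,
  Lemma 10.5, Prop. 10.8 (i)} (`vonKanel2014_sUnit_height_le_of_roots`).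
* `second_display_lt_murtyPasten` — `… < 4.8 N log N + 13N + 25`; hence `MurtyPasten.sUnit_height_lt` /
  `abc_log_max_lt` (MP Thm 1.1 / 1.2, explicit) from Prop. 10.6 and from the roots (the tree's
  `MurtyPasten.sUnit_height_lt_of_vonKanelMatschke` uses the FIRST display of Prop. 10.2, derived from the
  roots only for `N_S ≥ 53`; the second display covers every `S`); the asymptotic parts
  `MurtyPasten.sUnit_height_asymptotic` (from the second display, threshold `2²³`, `O`-constant `0`) and
  `MurtyPasten.abc_log_max_asymptotic` (from vKM (eq:asymptoticsu), `(9/5) r log r + O(r log r/log log r)`).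
* `vonKanel2014_mordell_height_le` (vK Cor. 7.4, `h(a) + 4·36a_S (log 36a_S)²`) from `mordell_height_le`
  (Prop. 10.1, `Ω_sim`; `a_S ≥ 1728`), hence from {modularity, Lemma 10.3, Prop. 10.8 (i)}; and
  `vonKanel2014_mordell_height_le_rpow` (vK Cor. 7.5) from Cor. 7.4 with the explicit constant `16/ε²`.

After this file vK 2014 Cor. 7.2, 7.4, 7.5 and MP 2013 Thm 1.1, 1.2 (all four clauses) are DERIVED from
the vKM §10 roots {`nonempty_modularParametrizationData`, `vonKanelMatschke_prop_10_8_i`,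
`vonKanelMatschke_lemma_10_3` / `_10_5`, Ogg–Saito schema}. NOT derived (count statements, printed via the
moduli schemes `M(𝒫)` of vK Thm 7.1): vK Cor. 7.3, 7.6. No `abc` claim; axioms standard.
-/

noncomputable section

open Height
open Literature.NumberTheory.EllipticCurves.ModularForms

namespace Literature.NumberTheory.DiophantineGeometry

namespace VonKanelMatschke

/-! ### Real-analysis helpers -/

/-- `log log log x ≤ log x − 2` for `x ≥ 16` (`log 16 = 4 log 2 > 1`, then `log u ≤ u − 1` twice).
[folklore] -/
private theorem logloglog_le_log_sub_two {x : ℝ} (hx : 16 ≤ x) :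
    Real.log (Real.log (Real.log x)) ≤ Real.log x - 2 := by
  have hl2 := Real.log_two_gt_d9
  have h16 : Real.log 16 = 4 * Real.log 2 := by
    rw [show (16 : ℝ) = 2 ^ 4 by norm_num, Real.log_pow]; push_cast; ring
  have hlx : 1 < Real.log x := by
    have := Real.log_le_log (by norm_num) hx
    linarith
  have h1 := Real.log_le_sub_one_of_pos (Real.log_pos hlx)
  have h2 : Real.log (Real.log x) ≤ Real.log x - 1 := Real.log_le_sub_one_of_pos (by linarith)
  linarith

/-- The second display of vKM Prop. 10.2 against the cruder shape `3.3 N log N + 8.96 N + 28`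
(real `N ≥ 1`; `log₃(16N) ≤ log(16N) − 2 = 4 log 2 − 2 + log N ≤ log N + 0.7726`).
[cite: VonkanelMatschke2023, Prop. 10.2 (arXiv §10.1.2, prop:su), second display] -/
theorem second_display_le_crude {N : ℝ} (hN : 1 ≤ N) :
    12 / 5 * N * Real.log N + 9 / 10 * N * Real.log (Real.log (Real.log (16 * N))) + 8.26 * N + 28 ≤
      3.3 * N * Real.log N + 8.96 * N + 28 := by
  have hl2 := Real.log_two_lt_d9
  have hN0 : 0 ≤ N := by linarith
  have h16 : Real.log (16 * N) = 4 * Real.log 2 + Real.log N := by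
    rw [Real.log_mul (by norm_num) (by linarith), show (16 : ℝ) = 2 ^ 4 by norm_num, Real.log_pow]
    push_cast; ring
  have h3 : Real.log (Real.log (Real.log (16 * N))) ≤ Real.log (16 * N) - 2 :=
    logloglog_le_log_sub_two (by linarith)
  have h4 : Real.log (Real.log (Real.log (16 * N))) ≤ Real.log N + 0.7726 := by linarith
  have h5 : 9 / 10 * N * Real.log (Real.log (Real.log (16 * N))) ≤ 9 / 10 * N * (Real.log N + 0.7726) :=
    mul_le_mul_of_nonneg_left h4 (by positivity)
  linarith

/-- **The second display of vKM Prop. 10.2 is dominated by von Känel's 2014 bound**: for real `N ≥ 1`,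
`(12/5)N log N + (9/10)N log log log(16N) + 8.26N + 28 ≤ (3/2)·2⁷N·(log 2⁷N)² + 65` (vKM §10.1.2:
Prop. 10.2 "updates … `h ≤ 3·2⁶N_S log(2⁷N_S)² + 65` in [rvk:modular]"; here `log(2⁷N) ≥ 7 log 2 > 4`).
[cite: VonkanelMatschke2023, §10.1.2 (comparison after Prop. 10.2)] -/
theorem second_display_le_vonKanel2014 {N : ℝ} (hN : 1 ≤ N) :
    12 / 5 * N * Real.log N + 9 / 10 * N * Real.log (Real.log (Real.log (16 * N))) + 8.26 * N + 28 ≤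
      3 / 2 * (2 ^ 7 * N) * Real.log (2 ^ 7 * N) ^ 2 + 65 := by
  have hl2 := Real.log_two_gt_d9
  have hN0 : 0 ≤ N := by linarith
  have hlogN : 0 ≤ Real.log N := Real.log_nonneg hN
  have hL : Real.log (2 ^ 7 * N) = 7 * Real.log 2 + Real.log N := by
    rw [Real.log_mul (by norm_num) (by linarith), Real.log_pow]; push_cast; ring
  set L := Real.log (2 ^ 7 * N) with hLdef
  have hL4 : 4 ≤ L := by rw [hL]; linarith
  have hlogN_le : Real.log N ≤ L := by rw [hL]; linarith
  have h1 := second_display_le_crude hN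
  have h2 : N * Real.log N ≤ N * L := mul_le_mul_of_nonneg_left hlogN_le hN0
  have h3 : 4 * N ≤ N * L := by nlinarith
  have h4 : 4 * (N * L) ≤ N * L ^ 2 := by nlinarith [mul_nonneg hN0 (by linarith : (0 : ℝ) ≤ L)]
  nlinarith

/-- **The second display of vKM Prop. 10.2 is (strictly) dominated by Murty–Pasten's explicit bound**:
for real `N ≥ 1`, `(12/5)N log N + (9/10)N log₃(16N) + 8.26N + 28 < 4.8 N log N + 13N + 25` (vKM §10.1.2:
Prop. 10.2 "updates the inequalities `h ≤ 4.8N_S log N_S + 13N_S + 25` in Murty–Pasten").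
[cite: VonkanelMatschke2023, §10.1.2 (comparison after Prop. 10.2)] -/
theorem second_display_lt_murtyPasten {N : ℝ} (hN : 1 ≤ N) :
    12 / 5 * N * Real.log N + 9 / 10 * N * Real.log (Real.log (Real.log (16 * N))) + 8.26 * N + 28 <
      4.8 * N * Real.log N + 13 * N + 25 := by
  have h1 := second_display_le_crude hN
  have hlogN : 0 ≤ Real.log N := Real.log_nonneg hN
  have h2 : 0 ≤ N * Real.log N := mul_nonneg (by linarith) hlogN
  linarith

/-- The second display of vKM Prop. 10.2 is at most `4 N log N` once `N ≥ 2²³` (`log N ≥ 23 log 2 > 15.9`,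
so `8.96N + 28 ≤ 9.96 N ≤ 0.7 N log N`). [cite: VonkanelMatschke2023, Prop. 10.2 (arXiv §10.1.2), second display] -/
theorem second_display_le_four_mul {N : ℝ} (hN : (2 : ℝ) ^ 23 ≤ N) :
    12 / 5 * N * Real.log N + 9 / 10 * N * Real.log (Real.log (Real.log (16 * N))) + 8.26 * N + 28 ≤
      4 * N * Real.log N := by
  have hl2 := Real.log_two_gt_d9
  have hN1 : (1 : ℝ) ≤ N := le_trans (by norm_num) hN
  have h1 := second_display_le_crude hN1
  have hlogN : 23 * Real.log 2 ≤ Real.log N := by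
    have := Real.log_le_log (by positivity) hN
    rwa [Real.log_pow] at this
  have h15 : (15.9 : ℝ) ≤ Real.log N := by linarith
  have h28 : (28 : ℝ) ≤ N := le_trans (by norm_num) hN
  have h2 : 15.9 * N ≤ N * Real.log N := by nlinarith
  linarith

/-! ### von Känel 2014, Cor. 7.2 (`S`-unit equation) from vKM Prop. 10.2 / Prop. 10.6 / the roots -/

/-- **vK 2014 Cor. 7.2 ⇐ vKM Prop. 10.6** (through the second display of Prop. 10.2, valid for every
finite set of primes `S`: `sUnitEquation_height_le_two_of_abc_log_max_le_refined`, then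
`second_display_le_vonKanel2014` with `N_S ≥ 1`). [cite: VonkanelMatschke2023, §10.1.2 (Prop. 10.2 updates [rvk:modular])]
[cite: VonKanelModuli2014, Cor. 7.2] -/
theorem vonKanel2014_sUnit_height_le_of_abc_log_max_le_refined (h : abc_log_max_le_refined) :
    vonKanel2014_sUnit_height_le := by
  intro S hS x y hx hy hxy
  have h1 := sUnitEquation_height_le_two_of_abc_log_max_le_refined h S hS x y hx hy hxy
  have hN : (1 : ℝ) ≤ (primesProd S : ℝ) := by exact_mod_cast one_le_primesProd hS
  exact h1.trans (second_display_le_vonKanel2014 hN)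

/-- **vK 2014 Cor. 7.2 ⇐ vKM Prop. 10.2** (the named fact, second display).
[cite: VonkanelMatschke2023, §10.1.2 (Prop. 10.2 updates [rvk:modular])] [cite: VonKanelModuli2014, Cor. 7.2] -/
theorem vonKanel2014_sUnit_height_le_of_sUnitEquation_height_le (h : sUnitEquation_height_le) :
    vonKanel2014_sUnit_height_le := by
  intro S hS x y hx hy hxy
  have h1 := (h S hS x y hx hy hxy).2
  have hN : (1 : ℝ) ≤ (primesProd S : ℝ) := by exact_mod_cast one_le_primesProd hS
  exact h1.trans (second_display_le_vonKanel2014 hN)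

/-- **vK 2014 Cor. 7.2 from the vKM §10 roots**: modularity, the Ogg–Saito schema, Lemma 10.5 and
Prop. 10.8 (i) (`abc_log_max_le_refined_of_modularity_of_prop_10_8_i`). The named fact
`vonKanel2014_sUnit_height_le` is no longer an independent root.
[cite: VonKanelModuli2014, Cor. 7.2] [cite: VonkanelMatschke2023, §10.1.2 and §10.4–§10.5] -/
theorem vonKanel2014_sUnit_height_le_of_roots (hmod : nonempty_modularParametrizationData)
    (hOS : ∀ (W : WeierstrassCurve ℚ) (ℓ : ℕ) [Fact ℓ.Prime],
      W.artinConductorExponent_tate_eq_conductorExponent_of_isElliptic ℓ)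
    (h105 : vonKanelMatschke_lemma_10_5) (hi : vonKanelMatschke_prop_10_8_i) :
    vonKanel2014_sUnit_height_le :=
  vonKanel2014_sUnit_height_le_of_abc_log_max_le_refined
    (abc_log_max_le_refined_of_modularity_of_prop_10_8_i hmod hOS h105 hi)

/-! ### von Känel 2014, Cor. 7.4 and Cor. 7.5 (Mordell equation) from vKM Prop. 10.1 / the roots -/

/-- **`Ω_sim` against von Känel's 2014 Mordell bound**: for real `a ≥ 1728` and `h ≥ 0`,
`(3/2)·((1/3)h + (4/9)a log a + (1/6)a log₃ a + (2/5)a) ≤ h + 4·(36a)·(log 36a)²` (and the same for the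
bound itself), since `log₃ a ≤ log a − 2 ≤ log(36a)` and `log(36a) ≥ 1`.
[cite: VonkanelMatschke2023, §10.1.1 (Prop. 10.1 updates [rvk:modular])] -/
theorem omegaSim_shape_le_vonKanel2014 {a h : ℝ} (ha : 1728 ≤ a) (hh : 0 ≤ h) :
    1 / 3 * h + 4 / 9 * a * Real.log a + 1 / 6 * a * Real.log (Real.log (Real.log a)) + 2 / 5 * a ≤
        h + 4 * (36 * a) * Real.log (36 * a) ^ 2 ∧
    3 / 2 * (1 / 3 * h + 4 / 9 * a * Real.log a + 1 / 6 * a * Real.log (Real.log (Real.log a)) + 2 / 5 * a) ≤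
        h + 4 * (36 * a) * Real.log (36 * a) ^ 2 := by
  have hl2 := Real.log_two_gt_d9
  have ha0 : 0 ≤ a := by linarith
  have hloga : 1 ≤ Real.log a := by
    have h16 : Real.log 16 = 4 * Real.log 2 := by
      rw [show (16 : ℝ) = 2 ^ 4 by norm_num, Real.log_pow]; push_cast; ring
    have := Real.log_le_log (by norm_num) (show (16 : ℝ) ≤ a by linarith)
    linarith
  have hM : Real.log a ≤ Real.log (36 * a) := Real.log_le_log (by linarith) (by linarith)
  set M := Real.log (36 * a) with hMdef
  have hM1 : 1 ≤ M := hloga.trans hM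
  have h3 : Real.log (Real.log (Real.log a)) ≤ M := by
    have := logloglog_le_log_sub_two (show (16 : ℝ) ≤ a by linarith)
    linarith
  have t1 : a * Real.log a ≤ a * M := mul_le_mul_of_nonneg_left hM ha0
  have t2 : a * Real.log (Real.log (Real.log a)) ≤ a * M := mul_le_mul_of_nonneg_left h3 ha0
  have t3 : a ≤ a * M := by nlinarith
  have t4 : a * M ≤ a * M ^ 2 := by nlinarith [mul_nonneg ha0 (by linarith : (0 : ℝ) ≤ M)]
  constructor <;> nlinarith

/-- **vK 2014 Cor. 7.4 ⇐ vKM Prop. 10.1** (`max(h(x), (2/3)h(y)) ≤ Ω_sim` gives `h(x) ≤ Ω_sim`,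
`h(y) ≤ (3/2)Ω_sim`, both `≤ h(a) + 4·36a_S (log 36a_S)²` by `omegaSim_shape_le_vonKanel2014`, `a_S ≥ 1728`).
[cite: VonkanelMatschke2023, §10.1.1 (Prop. 10.1 updates [rvk:modular])] [cite: VonKanelModuli2014, Cor. 7.4] -/
theorem vonKanel2014_mordell_height_le_of_mordell_height_le (h : mordell_height_le) :
    vonKanel2014_mordell_height_le := by
  intro S hS a ha haS x y hx hy hxy
  have h1 := h S hS a ha haS x y hx hy hxy
  have hA : (1728 : ℝ) ≤ (mordellLevel S a : ℝ) := by exact_mod_cast le_mordellLevel hS a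
  have hh : 0 ≤ logHeight₁ a := zero_le_logHeight₁ a
  obtain ⟨b1, b2⟩ := omegaSim_shape_le_vonKanel2014 hA hh
  have hx1 : logHeight₁ x ≤ omegaSim S a := (le_max_left _ _).trans h1
  have hy1 : logHeight₁ y ≤ 3 / 2 * omegaSim S a := by
    have := (le_max_right _ _).trans h1
    linarith
  rw [omegaSim] at hx1 hy1
  exact max_le (by linarith) (by linarith)

/-- **vK 2014 Cor. 7.4 ⇐ vKM Prop. 10.7** (the optimized bound implies Prop. 10.1,
`mordell_height_le_of_proposition_10_7'`). [cite: VonkanelMatschke2023, §10.1.1 and §10.5.1] [cite: VonKanelModuli2014, Cor. 7.4] -/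
theorem vonKanel2014_mordell_height_le_of_proposition_10_7 (h : proposition_10_7) :
    vonKanel2014_mordell_height_le :=
  vonKanel2014_mordell_height_le_of_mordell_height_le (mordell_height_le_of_proposition_10_7' h)

/-- **vK 2014 Cor. 7.4 from the vKM §10 roots**: modularity, Lemma 10.3 and Prop. 10.8 (i)
(`mordell_height_le_of_lemma_10_3_of_prop_10_8_i`). [cite: VonKanelModuli2014, Cor. 7.4]
[cite: VonkanelMatschke2023, §10.1.1 and §10.3] -/
theorem vonKanel2014_mordell_height_le_of_roots (hmod : nonempty_modularParametrizationData)
    (h103 : vonKanelMatschke_lemma_10_3) (hi : vonKanelMatschke_prop_10_8_i) :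
    vonKanel2014_mordell_height_le :=
  vonKanel2014_mordell_height_le_of_mordell_height_le
    (mordell_height_le_of_lemma_10_3_of_prop_10_8_i hmod h103 hi)

/-- `4 A (log A)² ≤ (16/ε²) A^{1+ε}` for real `A ≥ 1`, `ε > 0` (`log A ≤ A^{ε/2}/(ε/2)`,
`Real.log_le_rpow_div`) — the step behind "Cor. 7.5 is a direct consequence of Cor. 7.4" (vK §7.3.4).
[cite: VonKanelModuli2014, §7.3.4 (Cor. 7.5 from Cor. 7.4)] -/
private theorem four_mul_mul_log_sq_le_rpow {A ε : ℝ} (hA : 1 ≤ A) (hε : 0 < ε) :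
    4 * A * Real.log A ^ 2 ≤ 16 / ε ^ 2 * A ^ (1 + ε) := by
  have hA0 : 0 < A := by linarith
  have hlog0 : 0 ≤ Real.log A := Real.log_nonneg hA
  have h1 : Real.log A ≤ A ^ (ε / 2) / (ε / 2) := Real.log_le_rpow_div hA0.le (by linarith)
  have hpow0 : 0 ≤ A ^ (ε / 2) := Real.rpow_nonneg hA0.le _
  have h2 : Real.log A ^ 2 ≤ (A ^ (ε / 2) / (ε / 2)) ^ 2 := pow_le_pow_left₀ hlog0 h1 2
  have h3 : (A ^ (ε / 2) / (ε / 2)) ^ 2 = 4 / ε ^ 2 * A ^ ε := by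
    have : (A ^ (ε / 2)) ^ 2 = A ^ ε := by
      rw [← Real.rpow_natCast, ← Real.rpow_mul hA0.le]; norm_num
    rw [div_pow, this]; ring
  have h4 : A ^ (1 + ε) = A * A ^ ε := by rw [Real.rpow_add hA0, Real.rpow_one]
  rw [h4]
  have hAε : 0 ≤ A ^ ε := Real.rpow_nonneg hA0.le _
  calc 4 * A * Real.log A ^ 2 ≤ 4 * A * (4 / ε ^ 2 * A ^ ε) := by
        rw [← h3]; exact mul_le_mul_of_nonneg_left h2 (by linarith)
    _ = 16 / ε ^ 2 * (A * A ^ ε) := by ring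

/-- **vK 2014 Cor. 7.5 ⇐ Cor. 7.4** ("a direct consequence of Corollary (cor:m)", vK §7.3.4), with the
explicit constant `c(ε) = 16/ε²`: `h(a) + 4 a_S (log a_S)² ≤ h(a) + (16/ε²) a_S^{1+ε}` (`a_S ≥ 1`, 2014
normalisation `a_S = 36 · mordellLevel`). [cite: VonKanelModuli2014, Cor. 7.5 (§7.3.4)] -/
theorem vonKanel2014_mordell_height_le_rpow_of_mordell_height_le_2014
    (h : vonKanel2014_mordell_height_le) : vonKanel2014_mordell_height_le_rpow := by
  intro ε hε
  refine ⟨16 / ε ^ 2, fun S hS a ha haS x y hx hy hxy => ?_⟩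
  have h1 := h S hS a ha haS x y hx hy hxy
  have hA : (1 : ℝ) ≤ (36 * mordellLevel S a : ℝ) := by
    have : (1728 : ℝ) ≤ (mordellLevel S a : ℝ) := by exact_mod_cast le_mordellLevel hS a
    linarith
  have h2 := four_mul_mul_log_sq_le_rpow hA hε
  exact h1.trans (by linarith)

/-- **vK 2014 Cor. 7.5 ⇐ vKM Prop. 10.1.** [cite: VonKanelModuli2014, Cor. 7.5] [cite: VonkanelMatschke2023, §10.1.1] -/
theorem vonKanel2014_mordell_height_le_rpow_of_mordell_height_le (h : mordell_height_le) :
    vonKanel2014_mordell_height_le_rpow :=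
  vonKanel2014_mordell_height_le_rpow_of_mordell_height_le_2014
    (vonKanel2014_mordell_height_le_of_mordell_height_le h)

/-- **vK 2014 Cor. 7.5 from the vKM §10 roots** (modularity, Lemma 10.3, Prop. 10.8 (i)).
[cite: VonKanelModuli2014, Cor. 7.5] [cite: VonkanelMatschke2023, §10.1.1 and §10.3] -/
theorem vonKanel2014_mordell_height_le_rpow_of_roots (hmod : nonempty_modularParametrizationData)
    (h103 : vonKanelMatschke_lemma_10_3) (hi : vonKanelMatschke_prop_10_8_i) :
    vonKanel2014_mordell_height_le_rpow :=
  vonKanel2014_mordell_height_le_rpow_of_mordell_height_le_2014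
    (vonKanel2014_mordell_height_le_of_roots hmod h103 hi)

end VonKanelMatschke

/-! ### Murty–Pasten 2013, Thm 1.1 / 1.2 (explicit and asymptotic) from vKM Prop. 10.6 / the roots -/

namespace MurtyPasten

open VonKanelMatschke UniqueFactorizationMonoid

/-- **MP Thm 1.1 (explicit) ⇐ vKM Prop. 10.6**, through the second display of Prop. 10.2 for every `S`
(`second_display_lt_murtyPasten`; the tree's `sUnit_height_lt_of_vonKanelMatschke` uses the first display).
[cite: VonkanelMatschke2023, §10.1.2 (Prop. 10.2 updates Murty–Pasten)] [cite: MurtyPasten2013, Thm 1.1 (p. 3740)] -/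
theorem sUnit_height_lt_of_abc_log_max_le_refined (h : abc_log_max_le_refined) : sUnit_height_lt := by
  intro S hS U V hU hV hUV
  have h1 := sUnitEquation_height_le_two_of_abc_log_max_le_refined h S hS U V hU hV hUV
  have hN : (1 : ℝ) ≤ (primesProd S : ℝ) := by exact_mod_cast one_le_primesProd hS
  exact h1.trans_lt (second_display_lt_murtyPasten hN)

/-- **MP Thm 1.1 (explicit) from the vKM §10 roots** (modularity, Ogg–Saito, Lemma 10.5, Prop. 10.8 (i)).
[cite: MurtyPasten2013, Thm 1.1 (p. 3740)] [cite: VonkanelMatschke2023, §10.1.2 and §10.4–§10.5] -/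
theorem sUnit_height_lt_of_roots (hmod : nonempty_modularParametrizationData)
    (hOS : ∀ (W : WeierstrassCurve ℚ) (ℓ : ℕ) [Fact ℓ.Prime],
      W.artinConductorExponent_tate_eq_conductorExponent_of_isElliptic ℓ)
    (h105 : vonKanelMatschke_lemma_10_5) (hi : vonKanelMatschke_prop_10_8_i) : sUnit_height_lt :=
  sUnit_height_lt_of_abc_log_max_le_refined
    (abc_log_max_le_refined_of_modularity_of_prop_10_8_i hmod hOS h105 hi)

/-- **MP Thm 1.2 (explicit `abc` bound `4.8 R log R + 13 R + 25`) from the vKM §10 roots**, via the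
tree's PROVED equivalence `sUnit_height_lt_iff_abc_log_max_lt` ("an equivalent way to state" Thm 1.1).
[cite: MurtyPasten2013, Thm 1.2 (p. 3741)] [cite: VonkanelMatschke2023, §10.1.2 and §10.4–§10.5] -/
theorem abc_log_max_lt_of_roots (hmod : nonempty_modularParametrizationData)
    (hOS : ∀ (W : WeierstrassCurve ℚ) (ℓ : ℕ) [Fact ℓ.Prime],
      W.artinConductorExponent_tate_eq_conductorExponent_of_isElliptic ℓ)
    (h105 : vonKanelMatschke_lemma_10_5) (hi : vonKanelMatschke_prop_10_8_i) : abc_log_max_lt :=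
  abc_log_max_lt_of_sUnit_height_lt (sUnit_height_lt_of_roots hmod hOS h105 hi)

/-- **MP Thm 1.1, asymptotic part (`max(h(U),h(V)) ≤ 4P log P + O(P log log P)`) ⇐ vKM Prop. 10.6**:
the second display of Prop. 10.2 is `≤ 4 N_S log N_S` for `N_S ≥ 2²³` (`second_display_le_four_mul`), so
the constant `C = 0` and the threshold `P₀ = 2²³` witness the statement.
[cite: MurtyPasten2013, Thm 1.1 (p. 3740, second display)] [cite: VonkanelMatschke2023, Prop. 10.2 (arXiv §10.1.2)] -/
theorem sUnit_height_asymptotic_of_abc_log_max_le_refined (h : abc_log_max_le_refined) :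
    sUnit_height_asymptotic := by
  refine ⟨0, (2 : ℝ) ^ 23, fun S hS hP U V hU hV hUV => ?_⟩
  have h1 := sUnitEquation_height_le_two_of_abc_log_max_le_refined h S hS U V hU hV hUV
  have h2 := second_display_le_four_mul hP
  simp only [zero_mul, add_zero]
  exact h1.trans h2

/-- **MP Thm 1.1, asymptotic part, from the vKM §10 roots.**
[cite: MurtyPasten2013, Thm 1.1 (p. 3740, second display)] [cite: VonkanelMatschke2023, §10.4–§10.5] -/
theorem sUnit_height_asymptotic_of_roots (hmod : nonempty_modularParametrizationData)
    (hOS : ∀ (W : WeierstrassCurve ℚ) (ℓ : ℕ) [Fact ℓ.Prime],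
      W.artinConductorExponent_tate_eq_conductorExponent_of_isElliptic ℓ)
    (h105 : vonKanelMatschke_lemma_10_5) (hi : vonKanelMatschke_prop_10_8_i) :
    sUnit_height_asymptotic :=
  sUnit_height_asymptotic_of_abc_log_max_le_refined
    (abc_log_max_le_refined_of_modularity_of_prop_10_8_i hmod hOS h105 hi)

/-- **MP Thm 1.2, asymptotic part (`log max ≤ 4R log R + O(R log log R)`) ⇐ vKM (eq:asymptoticsu)**
(`(9/5) r log r + O(r log r/log log r)`, "improving Murty–Pasten's `4 r log r + O(r log log r)`"): with
vKM's constant `C'` and threshold `r₀'`, for `r ≥ max(r₀', exp(exp(max(1,|C'|))))` one has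
`log log r ≥ max(1, |C'|)`, so `C' · r log r/log log r ≤ r log r` and the bound is `≤ (14/5) r log r ≤ 4 r log r`
(constant `C = 0`). [cite: MurtyPasten2013, Thm 1.2 (p. 3741, second display)]
[cite: VonkanelMatschke2023, §10.4 display (eq:asymptoticsu)] -/
theorem abc_log_max_asymptotic_of_eq_asymptoticsu (h : eq_asymptoticsu) : abc_log_max_asymptotic := by
  obtain ⟨C', r₀', hC⟩ := h
  set M : ℝ := max 1 |C'| with hMdef
  refine ⟨0, max r₀' (Real.exp (Real.exp M)), fun a b c ha hb hc habc hg hr => ?_⟩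
  have hr₀ : r₀' ≤ ((radical (a * b * c).natAbs : ℕ) : ℝ) := (le_max_left _ _).trans hr
  have hrexp : Real.exp (Real.exp M) ≤ ((radical (a * b * c).natAbs : ℕ) : ℝ) := (le_max_right _ _).trans hr
  have h1 := hC a b c ha hb hc habc hg (by rw [intRad_def]; exact hr₀)
  rw [intRad_def] at h1
  set r : ℝ := ((radical (a * b * c).natAbs : ℕ) : ℝ) with hrdef
  have hM1 : 1 ≤ M := le_max_left _ _
  have hMC : |C'| ≤ M := le_max_right _ _
  have hrpos : 0 < r := lt_of_lt_of_le (Real.exp_pos _) hrexp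
  have hlogr : Real.exp M ≤ Real.log r := by
    rw [Real.le_log_iff_exp_le hrpos]; exact hrexp
  have hlogr_pos : 0 < Real.log r := lt_of_lt_of_le (Real.exp_pos _) hlogr
  have hllr : M ≤ Real.log (Real.log r) := by
    rw [Real.le_log_iff_exp_le hlogr_pos]; exact hlogr
  have hllr_pos : 0 < Real.log (Real.log r) := by linarith
  have hX : 0 ≤ r * Real.log r := mul_nonneg hrpos.le hlogr_pos.le
  have hkey : C' * (r * Real.log r / Real.log (Real.log r)) ≤ r * Real.log r := by
    have h2 : C' * (r * Real.log r / Real.log (Real.log r)) ≤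
        |C'| * (r * Real.log r / Real.log (Real.log r)) :=
      mul_le_mul_of_nonneg_right (le_abs_self C') (div_nonneg hX hllr_pos.le)
    have h3 : |C'| * (r * Real.log r / Real.log (Real.log r)) =
        (|C'| / Real.log (Real.log r)) * (r * Real.log r) := by ring
    have h4 : |C'| / Real.log (Real.log r) ≤ 1 := by
      rw [div_le_one hllr_pos]; linarith
    calc C' * (r * Real.log r / Real.log (Real.log r))
        ≤ (|C'| / Real.log (Real.log r)) * (r * Real.log r) := by rw [← h3]; exact h2
      _ ≤ 1 * (r * Real.log r) := mul_le_mul_of_nonneg_right h4 hX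
      _ = r * Real.log r := one_mul _
  simp only [zero_mul, add_zero]
  calc Real.log ((max |a| (max |b| |c|) : ℤ) : ℝ)
      ≤ 9 / 5 * r * Real.log r + C' * (r * Real.log r / Real.log (Real.log r)) := h1
    _ ≤ 9 / 5 * r * Real.log r + r * Real.log r := by linarith
    _ ≤ 4 * r * Real.log r := by nlinarith

/-- **MP Thm 1.2, asymptotic part, from the vKM §10 roots** (`eq_asymptoticsu_of_roots`: modularity,
Ogg–Saito, Lemma 10.5, Prop. 10.8 (i)). [cite: MurtyPasten2013, Thm 1.2 (p. 3741, second display)]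
[cite: VonkanelMatschke2023, §10.4 display (eq:asymptoticsu) with §10.5.3] -/
theorem abc_log_max_asymptotic_of_roots (hmod : nonempty_modularParametrizationData)
    (hOS : ∀ (W : WeierstrassCurve ℚ) (ℓ : ℕ) [Fact ℓ.Prime],
      W.artinConductorExponent_tate_eq_conductorExponent_of_isElliptic ℓ)
    (h105 : vonKanelMatschke_lemma_10_5) (hi : vonKanelMatschke_prop_10_8_i) :
    abc_log_max_asymptotic :=
  abc_log_max_asymptotic_of_eq_asymptoticsu (eq_asymptoticsu_of_roots hmod hOS h105 hi)

end MurtyPasten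

end Literature.NumberTheory.DiophantineGeometry

end
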